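import Literature.NumberTheory.EllipticCurves.GreenbergSelmerNewform
import HarnessLib

/-!
# Involutions with a complement (`M = B ⊕ c(B)` has no Tate cohomology), and the cofree module `A = F²/𝒪²` of a framed
# rank-2 representation is such a module for every `c` with `c² = 1` that moves a `ϖ`-torsion class (residue characteristic `2`)

Topic `NumberTheory/EllipticCurves`, namespace `Literature.NumberTheory.EllipticCurves.GreenbergSelmer` (`Cofree ρ F`, `cofreeMk`,
`lattice`, `fracRepresentation`, `smul_cofreeMk` of `GreenbergSelmerNewform.lean`). THEOREMS ONLY (no definition, no named fact, no
instance, no notation, no `sorry`).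

* §1 (abstract): `c` an additive involution of `M`, `B ≤ M` with `B ∩ c(B) = 0` (`hinf`) and `B + c(B) = M` (`hsup`) ⟹
  `c a = -a ⟹ a = c b − b` (`exists_eq_sub_of_apply_eq_neg`, `Ĥ⁻¹ = 0`), `c a = a ⟹ a = b + c b` (`exists_eq_add_of_apply_eq`,
  `Ĥ⁰ = 0`), and `N • a = 0 ⟹ N • b = 0` (`…_of_zsmul_eq_zero`): induced modules are cohomologically trivial, elementwise.
* §2 (cofree module, ADAPTED lattice vector `w`: `{w, ρ(c)w}` spans `F²` and detects integrality): `B = F·w mod 𝒪²` is such a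
  complement ⟹ `Cofree.exists_eq_smul_sub_of_smul_eq_neg_of_zsmul_eq_zero` (on every `A[N]`; `N = 0` is the plain statement).
* §3: a UNIT off-diagonal entry `C₁₀` (resp. `C₀₁`) of `C = ρ(c)` makes `e₀` (resp. `e₁`) adapted ⟹ `…_of_isUnit`.
* §4 (`𝒪` local, `𝔪 = (ϖ) ∋ 2`): no unit off-diagonal entry + `c² = 1` ⟹ `C ≡ 1 (mod ϖ)` ⟹ `c` fixes `A[ϖ]`; contrapositively
  **`c` moves some `ϖ`-torsion class ⟹ on every `A[N]`, `c • a = −a ⟹ a = c • b − b` with `N • b = 0`**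
  (`Cofree.exists_eq_smul_sub_of_smul_eq_neg_of_exists_ne`).

Consumer: the EXACT reciprocity (EH) of crux RSL_g `ResidualSignedLambdaLowerCMAtTwo` (`Summits/BirchSwinnertonDyer`): §4 is the
hypothesis `hanti` of `localization_inl_shapiroLift_eq_zero_of_forall_antifixed` (`GaloisCohomology/CupProductLocalTermsShapiro.lean` §6) for
`A_ρ[2^k]`, `c` a complex conjugation, on the habitat `Δ_W < 0` (where `c` moves a point of `W[2] ↪ A_ρ[ϖ]`): the archimedean terms
of Poitou–Tate VANISH (card `Ideas/stub-cmlambdalower-k2-g9.md`, «regular at infinity»). Nothing here is specific to BSD.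

References: [Brown1982] K. S. Brown, *Cohomology of Groups* (1982), VI §8, III (9.5); [GreenbergLNM1716] R. Greenberg, LNM 1716
(1999), §3 (the archimedean factor); [Greenberg1989] §1 p. 98, §5 p. 32 (the `p = 2` corrections at `∞`).
-/

set_option autoImplicit false

noncomputable section

open scoped Classical

open Literature.NumberTheory.GaloisRepresentations

namespace Literature.NumberTheory.EllipticCurves.GreenbergSelmer

/-! ## §1 Abstract: an additive involution with a complement -/

section Abstract

variable {M : Type*} [AddCommGroup M] (c : M →+ M) (hc : ∀ m, c (c m) = m) (B : AddSubgroup M)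
  (hinf : ∀ x ∈ B, c x ∈ B → x = 0) (hsup : ∀ m : M, ∃ b₁ ∈ B, ∃ b₂ ∈ B, m = b₁ + c b₂)

include hc hinf hsup in
/-- **`Ĥ⁻¹(C₂, B ⊕ cB) = 0`, elementwise**: if `M = B + c(B)` with `B ∩ c(B) = 0` for an additive involution `c`, every antifixed element
is a coboundary — `c a = -a ⟹ a = c b − b` for some `b ∈ B`. (Write `a = b₁ + c b₂`; then `x = b₁ + b₂ ∈ B` has `c x = −x ∈ B`, so `x = 0`.)
[cite: Brown1982, VI §8 and III (9.5)] -/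
theorem exists_eq_sub_of_apply_eq_neg (a : M) (ha : c a = -a) : ∃ b ∈ B, a = c b - b := by
  obtain ⟨b₁, hb₁, b₂, hb₂, hab⟩ := hsup a
  have hx : c (b₁ + b₂) = -(b₁ + b₂) := by
    have h := ha
    rw [hab, map_add, hc] at h
    rw [map_add]
    have : c b₁ = -(b₁ + c b₂) - b₂ := eq_sub_of_add_eq h
    rw [this]
    abel
  have hxB : b₁ + b₂ ∈ B := B.add_mem hb₁ hb₂
  have hcxB : c (b₁ + b₂) ∈ B := by rw [hx]; exact B.neg_mem hxB
  have hx0 : b₁ + b₂ = 0 := hinf _ hxB hcxB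
  have hb₂' : b₂ = -b₁ := eq_neg_of_add_eq_zero_right hx0
  refine ⟨-b₁, B.neg_mem hb₁, ?_⟩
  rw [hab, hb₂', map_neg]
  abel

include hc hinf hsup in
/-- **`Ĥ⁰(C₂, B ⊕ cB) = 0`, elementwise**: every fixed element is a norm — `c a = a ⟹ a = b + c b` for some `b ∈ B`.
[cite: Brown1982, VI §8 and III (9.5)] -/
theorem exists_eq_add_of_apply_eq (a : M) (ha : c a = a) : ∃ b ∈ B, a = b + c b := by
  obtain ⟨b₁, hb₁, b₂, hb₂, hab⟩ := hsup a
  have hx : c (b₁ - b₂) = b₁ - b₂ := by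
    have h := ha
    rw [hab, map_add, hc] at h
    rw [map_sub]
    have : c b₁ = b₁ + c b₂ - b₂ := eq_sub_of_add_eq h
    rw [this]
    abel
  have hxB : b₁ - b₂ ∈ B := B.sub_mem hb₁ hb₂
  have hcxB : c (b₁ - b₂) ∈ B := by rw [hx]; exact hxB
  have hx0 : b₁ - b₂ = 0 := hinf _ hxB hcxB
  have hb₂' : b₂ = b₁ := (sub_eq_zero.mp hx0).symm
  exact ⟨b₁, hb₁, by rw [hab, hb₂']⟩

include hc hinf hsup in
/-- **Torsion refinement**: if moreover `N • a = 0` then the witness `b ∈ B` of `a = c b − b` is `N`-torsion (`N • b ∈ B` is fixed by `c`,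
hence in `B ∩ c(B) = 0`) — so §1 holds inside every `M[N]`. [cite: Brown1982, VI §8] -/
theorem exists_eq_sub_of_apply_eq_neg_of_zsmul_eq_zero (N : ℤ) (a : M) (hN : N • a = 0) (ha : c a = -a) :
    ∃ b ∈ B, N • b = 0 ∧ a = c b - b := by
  obtain ⟨b, hb, hab⟩ := exists_eq_sub_of_apply_eq_neg c hc B hinf hsup a ha
  refine ⟨b, hb, ?_, hab⟩
  have hfix : c (N • b) = N • b := by
    have h := hN
    rw [hab, zsmul_sub, ← map_zsmul] at h
    exact sub_eq_zero.mp h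
  exact hinf _ (B.zsmul_mem hb N) (by rw [hfix]; exact B.zsmul_mem hb N)

end Abstract

/-! ## §2 The cofree module of a framed rank-2 representation, for an element with an adapted lattice vector -/

section CofreeRegular

variable {G : Type*} [Group G] [TopologicalSpace G] {𝒪 : Type*} [CommRing 𝒪] [TopologicalSpace 𝒪]
  (F : Type*) [Field F] [Algebra 𝒪 F] (ρ : FramedRep G 𝒪 2) (c : G) {w : Fin 2 → F}

omit [TopologicalSpace G] [TopologicalSpace 𝒪] in
/-- `α • w ∈ 𝒪²` for `α ∈ 𝒪` and a lattice vector `w`. [cite: Greenberg1989, §1 p. 98] -/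
theorem algebraMap_smul_mem_lattice (hw : w ∈ lattice 2 𝒪 F) (a : 𝒪) : (algebraMap 𝒪 F a) • w ∈ lattice 2 𝒪 F := by
  rw [algebraMap_smul]
  exact (lattice 2 𝒪 F).smul_mem a hw

/-- `ρ(c)` is `F`-linear on `F²` (it is a matrix). [cite: Greenberg1989, §1 p. 98] -/
theorem fracRepresentation_smul (α : F) (x : Fin 2 → F) :
    fracRepresentation F ρ c (α • x) = α • fracRepresentation F ρ c x := by
  rw [fracRepresentation_apply_apply, fracRepresentation_apply_apply, Matrix.mulVec_smul]

/-- **The complement `B = F·w mod 𝒪²` and its translate `c(B) = F·ρ(c)w mod 𝒪²` meet trivially** when `{w, ρ(c)w}` detects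
integrality (`hint`): an element of `B` whose `c`-translate lies in `B` is `0`. [cite: Greenberg1989, §1 p. 98] -/
theorem cofree_smul_line_inf (hw : w ∈ lattice 2 𝒪 F)
    (hint : ∀ α β : F, α • fracRepresentation F ρ c w - β • w ∈ lattice 2 𝒪 F → ∃ a : 𝒪, algebraMap 𝒪 F a = α)
    (x : Cofree ρ F) (hx : ∃ α : F, cofreeMk F ρ (α • w) = x) (hcx : ∃ β : F, cofreeMk F ρ (β • w) = c • x) :
    x = 0 := by
  obtain ⟨α, rfl⟩ := hx
  obtain ⟨β, hβ⟩ := hcx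
  rw [smul_cofreeMk, fracRepresentation_smul] at hβ
  have hmem : α • fracRepresentation F ρ c w - β • w ∈ lattice 2 𝒪 F := by
    rw [← ker_cofreeMk (F := F) ρ, LinearMap.mem_ker, map_sub, hβ, sub_self]
  obtain ⟨a, rfl⟩ := hint α β hmem
  rw [← LinearMap.mem_ker, ker_cofreeMk]
  exact algebraMap_smul_mem_lattice F hw a

/-- **`B + c(B) = A`** when `{w, ρ(c)w}` spans `F²` (`hspan`): every class is `(α • w) + c • (β • w) mod 𝒪²`.
[cite: Greenberg1989, §1 p. 98] -/
theorem cofree_line_sup (hspan : ∀ x : Fin 2 → F, ∃ α β : F, x = α • w + β • fracRepresentation F ρ c w)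
    (m : Cofree ρ F) : ∃ α β : F, m = cofreeMk F ρ (α • w) + c • cofreeMk F ρ (β • w) := by
  obtain ⟨x, rfl⟩ := cofreeMk_surjective F ρ m
  obtain ⟨α, β, rfl⟩ := hspan x
  refine ⟨α, β, ?_⟩
  rw [smul_cofreeMk, fracRepresentation_smul, map_add]

/-- The complement `B = F·w mod 𝒪²` packaged with the two properties §1 needs (for `c² = 1` and an adapted lattice vector `w`).
[cite: Brown1982, VI §8] -/
theorem cofree_exists_complement (hc : c * c = 1) (hw : w ∈ lattice 2 𝒪 F)
    (hspan : ∀ x : Fin 2 → F, ∃ α β : F, x = α • w + β • fracRepresentation F ρ c w)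
    (hint : ∀ α β : F, α • fracRepresentation F ρ c w - β • w ∈ lattice 2 𝒪 F → ∃ a : 𝒪, algebraMap 𝒪 F a = α) :
    ∃ (cH : Cofree ρ F →+ Cofree ρ F) (B : AddSubgroup (Cofree ρ F)), (∀ m, cH m = c • m) ∧ (∀ m, cH (cH m) = m) ∧
      (∀ x ∈ B, cH x ∈ B → x = 0) ∧ (∀ m, ∃ b₁ ∈ B, ∃ b₂ ∈ B, m = b₁ + cH b₂) := by
  let f : F →+ Cofree ρ F := AddMonoidHom.mk' (fun α : F ↦ cofreeMk F ρ (α • w)) fun α β ↦ by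
    simp only [add_smul, map_add]
  have hf : ∀ α : F, f α = cofreeMk F ρ (α • w) := fun _ ↦ rfl
  refine ⟨(cofreeRepresentation F ρ c).toAddMonoidHom, f.range, fun _ ↦ rfl, fun m ↦ ?_, fun x hx hcx ↦ ?_, fun m ↦ ?_⟩
  · change c • c • m = m
    rw [← mul_smul, hc, one_smul]
  · obtain ⟨α, hα⟩ := AddMonoidHom.mem_range.1 hx
    obtain ⟨β, hβ⟩ := AddMonoidHom.mem_range.1 hcx
    exact cofree_smul_line_inf F ρ c hw hint x ⟨α, by rw [← hf, hα]⟩ ⟨β, by rw [← hf, hβ]; rfl⟩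
  · obtain ⟨α, β, hm⟩ := cofree_line_sup F ρ c hspan m
    exact ⟨f α, ⟨α, rfl⟩, f β, ⟨β, rfl⟩, hm⟩

/-- **No antifixed classes modulo coboundaries on the cofree module, on every `A[N]`**, for `c` with `c² = 1` and an ADAPTED
lattice vector `w` (`{w, ρ(c)w}` spans `F²` and detects integrality — e.g. an `𝒪`-basis of `𝒪²`): `N • a = 0`, `c • a = -a ⟹
a = c • b − b` with `N • b = 0` (`A ≅ (F/𝒪)[C₂]` is induced, hence cohomologically trivial; `N = 0` is the plain statement).
[cite: Brown1982, VI §8] [cite: GreenbergLNM1716, §3] -/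
theorem Cofree.exists_eq_smul_sub_of_smul_eq_neg_of_zsmul_eq_zero (hc : c * c = 1) (hw : w ∈ lattice 2 𝒪 F)
    (hspan : ∀ x : Fin 2 → F, ∃ α β : F, x = α • w + β • fracRepresentation F ρ c w)
    (hint : ∀ α β : F, α • fracRepresentation F ρ c w - β • w ∈ lattice 2 𝒪 F → ∃ a : 𝒪, algebraMap 𝒪 F a = α)
    (N : ℤ) (a : Cofree ρ F) (hN : N • a = 0) (ha : c • a = -a) : ∃ b : Cofree ρ F, N • b = 0 ∧ a = c • b - b := by
  obtain ⟨cH, B, hcH, hcc, hinf, hsup⟩ := cofree_exists_complement F ρ c hc hw hspan hint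
  obtain ⟨b, -, hNb, hb⟩ :=
    exists_eq_sub_of_apply_eq_neg_of_zsmul_eq_zero cH hcc B hinf hsup N a hN (by rw [hcH, ha])
  exact ⟨b, hNb, by rw [hb, hcH]⟩

end CofreeRegular

/-! ## §3 Adapted unit vectors: a UNIT off-diagonal entry of `ρ(c)` -/

section Adapted

variable {G : Type*} [Group G] [TopologicalSpace G] {𝒪 : Type*} [CommRing 𝒪] [TopologicalSpace 𝒪]
  (F : Type*) [Field F] [Algebra 𝒪 F] (ρ : FramedRep G 𝒪 2) (c : G)

/-- `ρ(c)` on `F²` in coordinates: `(ρ(c) x)_i = C_{i0} x_0 + C_{i1} x_1`. [cite: Greenberg1989, §1 p. 98] -/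
theorem fracRepresentation_apply_two (x : Fin 2 → F) (i : Fin 2) :
    fracRepresentation F ρ c x i =
      algebraMap 𝒪 F ((ρ c : Matrix (Fin 2) (Fin 2) 𝒪) i 0) * x 0 + algebraMap 𝒪 F ((ρ c : Matrix (Fin 2) (Fin 2) 𝒪) i 1) * x 1 := by
  rw [fracRepresentation_apply_apply, Matrix.mulVec, dotProduct, Fin.sum_univ_two, Matrix.map_apply, Matrix.map_apply]

omit [TopologicalSpace 𝒪] in
/-- The unit vectors `e_j ∈ F²` lie in the lattice `𝒪²`. [cite: Greenberg1989, §1 p. 98] -/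
theorem single_mem_lattice (j : Fin 2) : (Pi.single j 1 : Fin 2 → F) ∈ lattice 2 𝒪 F :=
  (mem_lattice_iff _).2 ⟨Pi.single j 1, funext fun i ↦ by
    by_cases h : i = j
    · subst h; simp
    · simp [Pi.single_eq_of_ne h]⟩

/-- `ρ(c) e_j` is the `j`-th column of `ρ(c)`. [cite: Greenberg1989, §1 p. 98] -/
theorem fracRepresentation_single (j : Fin 2) :
    fracRepresentation F ρ c (Pi.single j 1 : Fin 2 → F) = fun i ↦ algebraMap 𝒪 F ((ρ c : Matrix (Fin 2) (Fin 2) 𝒪) i j) := by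
  funext i
  rw [fracRepresentation_apply_two]
  fin_cases j <;> simp

/-- **`e₀` is adapted to `c` when `C₁₀` is a unit (spanning half)**: `{e₀, ρ(c)e₀}` spans `F²`. [cite: Greenberg1989, §1 p. 98] -/
theorem span_single_zero_of_isUnit (h : IsUnit ((ρ c : Matrix (Fin 2) (Fin 2) 𝒪) 1 0)) (x : Fin 2 → F) :
    ∃ α β : F, x = α • (Pi.single 0 1 : Fin 2 → F) + β • fracRepresentation F ρ c (Pi.single 0 1) := by
  obtain ⟨u, hu⟩ := h
  have hu1 : algebraMap 𝒪 F ((ρ c : Matrix (Fin 2) (Fin 2) 𝒪) 1 0) * algebraMap 𝒪 F ↑u⁻¹ = 1 := by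
    rw [← map_mul, ← hu, Units.mul_inv, map_one]
  refine ⟨x 0 - x 1 * algebraMap 𝒪 F ↑u⁻¹ * algebraMap 𝒪 F ((ρ c : Matrix (Fin 2) (Fin 2) 𝒪) 0 0),
    x 1 * algebraMap 𝒪 F ↑u⁻¹, ?_⟩
  rw [fracRepresentation_single]
  funext i
  fin_cases i
  · simp
  · simp only [Fin.mk_one, Fin.isValue, Pi.add_apply, Pi.smul_apply, ne_eq, one_ne_zero, not_false_eq_true,
      Pi.single_eq_of_ne, smul_eq_mul, mul_zero, zero_add]
    rw [mul_assoc, mul_comm (algebraMap 𝒪 F ↑u⁻¹), hu1, mul_one]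

/-- **`e₀` is adapted to `c` when `C₁₀` is a unit (integrality half)**: `α • ρ(c)e₀ − β • e₀ ∈ 𝒪² ⟹ α ∈ 𝒪`.
[cite: Greenberg1989, §1 p. 98] -/
theorem int_single_zero_of_isUnit (h : IsUnit ((ρ c : Matrix (Fin 2) (Fin 2) 𝒪) 1 0)) (α β : F)
    (hmem : α • fracRepresentation F ρ c (Pi.single 0 1) - β • (Pi.single 0 1 : Fin 2 → F) ∈ lattice 2 𝒪 F) :
    ∃ a : 𝒪, algebraMap 𝒪 F a = α := by
  obtain ⟨u, hu⟩ := h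
  have hu1 : algebraMap 𝒪 F ((ρ c : Matrix (Fin 2) (Fin 2) 𝒪) 1 0) * algebraMap 𝒪 F ↑u⁻¹ = 1 := by
    rw [← map_mul, ← hu, Units.mul_inv, map_one]
  rw [fracRepresentation_single] at hmem
  obtain ⟨y, hy⟩ := (mem_lattice_iff _).1 hmem
  have h1 := congr_fun hy 1
  simp only [Fin.isValue, Pi.sub_apply, Pi.smul_apply, smul_eq_mul, ne_eq, one_ne_zero, not_false_eq_true,
    Pi.single_eq_of_ne, mul_zero, sub_zero] at h1
  refine ⟨y 1 * ↑u⁻¹, ?_⟩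
  rw [map_mul, h1, mul_assoc, hu1, mul_one]

/-- **`e₁` is adapted to `c` when `C₀₁` is a unit (spanning half)**. [cite: Greenberg1989, §1 p. 98] -/
theorem span_single_one_of_isUnit (h : IsUnit ((ρ c : Matrix (Fin 2) (Fin 2) 𝒪) 0 1)) (x : Fin 2 → F) :
    ∃ α β : F, x = α • (Pi.single 1 1 : Fin 2 → F) + β • fracRepresentation F ρ c (Pi.single 1 1) := by
  obtain ⟨u, hu⟩ := h
  have hu1 : algebraMap 𝒪 F ((ρ c : Matrix (Fin 2) (Fin 2) 𝒪) 0 1) * algebraMap 𝒪 F ↑u⁻¹ = 1 := by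
    rw [← map_mul, ← hu, Units.mul_inv, map_one]
  refine ⟨x 1 - x 0 * algebraMap 𝒪 F ↑u⁻¹ * algebraMap 𝒪 F ((ρ c : Matrix (Fin 2) (Fin 2) 𝒪) 1 1),
    x 0 * algebraMap 𝒪 F ↑u⁻¹, ?_⟩
  rw [fracRepresentation_single]
  funext i
  fin_cases i
  · simp only [Fin.zero_eta, Fin.isValue, Pi.add_apply, Pi.smul_apply, ne_eq, zero_ne_one, not_false_eq_true,
      Pi.single_eq_of_ne, smul_eq_mul, mul_zero, zero_add]
    rw [mul_assoc, mul_comm (algebraMap 𝒪 F ↑u⁻¹), hu1, mul_one]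
  · simp

/-- **`e₁` is adapted to `c` when `C₀₁` is a unit (integrality half)**. [cite: Greenberg1989, §1 p. 98] -/
theorem int_single_one_of_isUnit (h : IsUnit ((ρ c : Matrix (Fin 2) (Fin 2) 𝒪) 0 1)) (α β : F)
    (hmem : α • fracRepresentation F ρ c (Pi.single 1 1) - β • (Pi.single 1 1 : Fin 2 → F) ∈ lattice 2 𝒪 F) :
    ∃ a : 𝒪, algebraMap 𝒪 F a = α := by
  obtain ⟨u, hu⟩ := h
  have hu1 : algebraMap 𝒪 F ((ρ c : Matrix (Fin 2) (Fin 2) 𝒪) 0 1) * algebraMap 𝒪 F ↑u⁻¹ = 1 := by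
    rw [← map_mul, ← hu, Units.mul_inv, map_one]
  rw [fracRepresentation_single] at hmem
  obtain ⟨y, hy⟩ := (mem_lattice_iff _).1 hmem
  have h0 := congr_fun hy 0
  simp only [Fin.isValue, Pi.sub_apply, Pi.smul_apply, smul_eq_mul, ne_eq, zero_ne_one, not_false_eq_true,
    Pi.single_eq_of_ne, mul_zero, sub_zero] at h0
  refine ⟨y 0 * ↑u⁻¹, ?_⟩
  rw [map_mul, h0, mul_assoc, hu1, mul_one]

/-- **A unit off-diagonal entry of `ρ(c)` (with `c² = 1`) makes `A = Cofree ρ F` cohomologically trivial for `c`, on every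
`A[N]`**: `N • a = 0`, `c • a = −a ⟹ a = c • b − b` with `N • b = 0`. [cite: Brown1982, VI §8] [cite: GreenbergLNM1716, §3] -/
theorem Cofree.exists_eq_smul_sub_of_smul_eq_neg_of_isUnit (hc : c * c = 1)
    (h : IsUnit ((ρ c : Matrix (Fin 2) (Fin 2) 𝒪) 1 0) ∨ IsUnit ((ρ c : Matrix (Fin 2) (Fin 2) 𝒪) 0 1))
    (N : ℤ) (a : Cofree ρ F) (hN : N • a = 0) (ha : c • a = -a) : ∃ b : Cofree ρ F, N • b = 0 ∧ a = c • b - b := by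
  rcases h with h | h
  · exact Cofree.exists_eq_smul_sub_of_smul_eq_neg_of_zsmul_eq_zero F ρ c hc (single_mem_lattice F 0)
      (span_single_zero_of_isUnit F ρ c h) (int_single_zero_of_isUnit F ρ c h) N a hN ha
  · exact Cofree.exists_eq_smul_sub_of_smul_eq_neg_of_zsmul_eq_zero F ρ c hc (single_mem_lattice F 1)
      (span_single_one_of_isUnit F ρ c h) (int_single_one_of_isUnit F ρ c h) N a hN ha

end Adapted

/-! ## §4 The local criterion: residue characteristic `2`, `c² = 1`, and `c` non-trivial on `A[ϖ]` -/

section Local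

variable {G : Type*} [Group G] [TopologicalSpace G] {𝒪 : Type*} [CommRing 𝒪] [TopologicalSpace 𝒪] [IsLocalRing 𝒪]
  (F : Type*) [Field F] [Algebra 𝒪 F] (ρ : FramedRep G 𝒪 2) (c : G)

omit [TopologicalSpace 𝒪] in
/-- In a local ring whose maximal ideal `𝔪 = (ϖ)` contains `2`: `u² − 1 ∈ … ` — precisely, if `u * u + t = 1` with `t ∈ 𝔪` then
`u − 1 ∈ 𝔪` (`(u − 1)(u + 1) ∈ 𝔪` and `u + 1 = (u − 1) + 2`). [folklore] -/
private theorem sub_one_mem_maximalIdeal_of_mul_self (h2 : (2 : 𝒪) ∈ IsLocalRing.maximalIdeal 𝒪) (u t : 𝒪)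
    (ht : t ∈ IsLocalRing.maximalIdeal 𝒪) (hu : u * u + t = 1) : u - 1 ∈ IsLocalRing.maximalIdeal 𝒪 := by
  have hprod : (u - 1) * (u + 1) ∈ IsLocalRing.maximalIdeal 𝒪 := by
    have e : (u - 1) * (u + 1) = -t := by linear_combination hu
    rw [e]
    exact (IsLocalRing.maximalIdeal 𝒪).neg_mem ht
  rcases (Ideal.IsMaximal.isPrime' (IsLocalRing.maximalIdeal 𝒪)).mem_or_mem hprod with h | h
  · exact h
  · have e : u - 1 = (u + 1) - 2 := by ring
    rw [e]
    exact Ideal.sub_mem _ h h2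

/-- **`ρ(c) ≡ 1 (mod 𝔪)` when `c² = 1`, `2 ∈ 𝔪` and NO off-diagonal entry of `ρ(c)` is a unit**: the off-diagonal entries lie in `𝔪`
(local ring), and `C² = 1` forces `C₀₀², C₁₁² ≡ 1`, whence `C₀₀, C₁₁ ≡ 1 (mod 𝔪)` in residue characteristic `2` — the matrix form of
«an involution of `k²`, `char k = 2`, is trivial iff diagonal». [cite: Greenberg1989, §5 (p. 32)] [cite: GreenbergLNM1716, §3] -/
theorem sub_one_apply_mem_maximalIdeal_of_not_isUnit (h2 : (2 : 𝒪) ∈ IsLocalRing.maximalIdeal 𝒪) (hc : c * c = 1)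
    (h10 : ¬ IsUnit ((ρ c : Matrix (Fin 2) (Fin 2) 𝒪) 1 0)) (h01 : ¬ IsUnit ((ρ c : Matrix (Fin 2) (Fin 2) 𝒪) 0 1)) (i j : Fin 2) :
    (ρ c : Matrix (Fin 2) (Fin 2) 𝒪) i j - (1 : Matrix (Fin 2) (Fin 2) 𝒪) i j ∈ IsLocalRing.maximalIdeal 𝒪 := by
  set C : Matrix (Fin 2) (Fin 2) 𝒪 := (ρ c : Matrix (Fin 2) (Fin 2) 𝒪) with hC
  have hCC : C * C = 1 := by
    rw [hC, ← Units.val_mul, ← map_mul, hc, map_one, Units.val_one]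
  have h10' : C 1 0 ∈ IsLocalRing.maximalIdeal 𝒪 := (IsLocalRing.mem_maximalIdeal _).mpr h10
  have h01' : C 0 1 ∈ IsLocalRing.maximalIdeal 𝒪 := (IsLocalRing.mem_maximalIdeal _).mpr h01
  have e00 : C 0 0 * C 0 0 + C 0 1 * C 1 0 = 1 := by
    have h := congr_fun (congr_fun hCC 0) 0
    rw [Matrix.mul_apply, Fin.sum_univ_two, Matrix.one_apply_eq] at h
    exact h
  have e11 : C 1 1 * C 1 1 + C 1 0 * C 0 1 = 1 := by
    have h := congr_fun (congr_fun hCC 1) 1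
    rw [Matrix.mul_apply, Fin.sum_univ_two, Matrix.one_apply_eq] at h
    rw [add_comm]
    exact h
  have h00 := sub_one_mem_maximalIdeal_of_mul_self h2 (C 0 0) _ (Ideal.mul_mem_right _ _ h01') e00
  have h11 := sub_one_mem_maximalIdeal_of_mul_self h2 (C 1 1) _ (Ideal.mul_mem_right _ _ h10') e11
  fin_cases i <;> fin_cases j
  · simpa using h00
  · simpa using h01'
  · simpa using h10'
  · simpa using h11

omit [IsLocalRing 𝒪] in
/-- **`c` acts trivially on `A[ϖ]` when `ρ(c) ≡ 1 (mod ϖ)`**: for `a = x mod 𝒪²` with `ϖ • x ∈ 𝒪²`, `ρ(c)x − x = ϖ⁻¹(C − 1)(ϖx) ∈ 𝒪²`.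
[cite: Greenberg1989, §1 p. 98] -/
theorem Cofree.smul_eq_of_forall_sub_one_mem_span (ϖ : 𝒪)
    (hC : ∀ i j, (ρ c : Matrix (Fin 2) (Fin 2) 𝒪) i j - (1 : Matrix (Fin 2) (Fin 2) 𝒪) i j ∈ Ideal.span {ϖ}) (a : Cofree ρ F) (hϖ : ϖ • a = 0) :
    c • a = a := by
  obtain ⟨x, rfl⟩ := cofreeMk_surjective F ρ a
  rw [← map_smul, ← LinearMap.mem_ker, ker_cofreeMk] at hϖ
  obtain ⟨y, hy⟩ := (mem_lattice_iff _).1 hϖ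
  choose d hd using fun i j ↦ Ideal.mem_span_singleton'.1 (hC i j)
  rw [smul_cofreeMk, ← sub_eq_zero, ← map_sub, ← LinearMap.mem_ker, ker_cofreeMk]
  refine (mem_lattice_iff _).2 ⟨fun i ↦ d i 0 * y 0 + d i 1 * y 1, funext fun i ↦ ?_⟩
  have hy0 : algebraMap 𝒪 F (y 0) = algebraMap 𝒪 F ϖ * x 0 := by
    have h := congr_fun hy 0
    rw [Pi.smul_apply, Algebra.smul_def] at h
    exact h
  have hy1 : algebraMap 𝒪 F (y 1) = algebraMap 𝒪 F ϖ * x 1 := by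
    have h := congr_fun hy 1
    rw [Pi.smul_apply, Algebra.smul_def] at h
    exact h
  have h00 : (ρ c : Matrix (Fin 2) (Fin 2) 𝒪) 0 0 = d 0 0 * ϖ + 1 := by
    have h := hd 0 0
    rw [Matrix.one_apply_eq] at h
    linear_combination (-1 : 𝒪) * h
  have h01 : (ρ c : Matrix (Fin 2) (Fin 2) 𝒪) 0 1 = d 0 1 * ϖ := by
    have h := hd 0 1
    rw [Matrix.one_apply_ne (by decide), sub_zero] at h
    exact h.symm
  have h10 : (ρ c : Matrix (Fin 2) (Fin 2) 𝒪) 1 0 = d 1 0 * ϖ := by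
    have h := hd 1 0
    rw [Matrix.one_apply_ne (by decide), sub_zero] at h
    exact h.symm
  have h11 : (ρ c : Matrix (Fin 2) (Fin 2) 𝒪) 1 1 = d 1 1 * ϖ + 1 := by
    have h := hd 1 1
    rw [Matrix.one_apply_eq] at h
    linear_combination (-1 : 𝒪) * h
  rw [Pi.sub_apply, fracRepresentation_apply_two]
  fin_cases i
  · simp only [Fin.zero_eta, Fin.isValue]
    rw [h00, h01, map_add, map_mul, map_mul, map_add, map_mul, map_one, map_mul, hy0, hy1]
    ring
  · simp only [Fin.mk_one, Fin.isValue]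
    rw [h10, h11, map_add, map_mul, map_mul, map_mul, map_add, map_mul, map_one, hy0, hy1]
    ring

/-- **The local criterion.** `𝒪` local with maximal ideal `(ϖ) ∋ 2`, `c² = 1`: if `c` moves SOME `ϖ`-torsion class of `A = Cofree ρ F`
(`ρ̄(c) ≠ 1`), then an off-diagonal entry of `ρ(c)` is a unit, so `A` (and every `A[N]`) is cohomologically trivial for `⟨c⟩`:
`N • a = 0`, `c • a = −a ⟹ a = c • b − b` with `N • b = 0`. In residue characteristic `2`, «`ρ̄(c) ≠ 1`» is thus the whole
habitat condition for the vanishing of the archimedean terms (Greenberg: at `p = 2` the factor at `∞` is `A^{c=1}/(1+c)A`, trivial iff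
`A` is `ℤ₂[C₂]`-regular). [cite: Brown1982, VI §8] [cite: GreenbergLNM1716, §3] [cite: Greenberg1989, §5 (p. 32)] -/
theorem Cofree.exists_eq_smul_sub_of_smul_eq_neg_of_exists_ne (ϖ : 𝒪) (hmax : (Ideal.span {ϖ}).IsMaximal)
    (h2 : (2 : 𝒪) ∈ Ideal.span {ϖ}) (hc : c * c = 1) (hne : ∃ a : Cofree ρ F, ϖ • a = 0 ∧ c • a ≠ a)
    (N : ℤ) (a : Cofree ρ F) (hN : N • a = 0) (ha : c • a = -a) : ∃ b : Cofree ρ F, N • b = 0 ∧ a = c • b - b := by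
  refine Cofree.exists_eq_smul_sub_of_smul_eq_neg_of_isUnit F ρ c hc ?_ N a hN ha
  by_contra h
  push Not at h
  have hm : Ideal.span {ϖ} = IsLocalRing.maximalIdeal 𝒪 := IsLocalRing.eq_maximalIdeal hmax
  obtain ⟨a₀, ha₀, hne₀⟩ := hne
  refine hne₀ (Cofree.smul_eq_of_forall_sub_one_mem_span F ρ c ϖ (fun i j ↦ ?_) a₀ ha₀)
  rw [hm]
  exact sub_one_apply_mem_maximalIdeal_of_not_isUnit ρ c (hm ▸ h2) hc h.1 h.2 i j

end Local

end Literature.NumberTheory.EllipticCurves.GreenbergSelmer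

end
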